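import Literature.MathematicalPhysics.QuantumLattice.FinDimSpectrumSectorGibbsLimit
import HarnessLib

/-!
# Barrier: order seen by an infinitesimal symmetry-breaking source, or at vanishing excess energy density, does not by itself give long-range order of the finite-volume ground states (Koma–Tasaki 1994 §2.5; Lieb–Seiringer–Yngvason 2007 §3)

Barrier catalogue `Literature/Barriers/HubbardSuperconductivity/` (D-0021), entry
`SourcedOrderWithoutGroundStateLRO`, for the summit `HubbardSuperconductivity` (`d_{x²-y²}` pair-field
long-range order `liminf_{L even} |Λ_L|⁻² ⟨ψ_L, Δ_d† Δ_d ψ_L⟩ > 0` of EVERY sequence of fixed-`(N, S^z)`-sector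
GROUND states `ψ_L` of the pure repulsive Hubbard model on even tori).  Several routes of the summit reach the
floor order in two steps: first an order that is visible only AFTER the thermodynamic limit — a Bogoliubov
quasi-average / order parameter under an infinitesimal `U(1)`-breaking source (`L → ∞` then `h ↓ 0`), a linear
energy response ("Josephson cusp") `E_L(0) − E_L(h) ≥ a·h·|Λ_L|` with a volume threshold `L₀(h)` depending on
`h`, or, equivalently at the level of states, order `‖O_L v_L‖² ≥ c|Λ_L|²` carried by sector states `v_L` of
excess energy `o(|Λ_L|)` above the sector floor — and then a TRANSFER of that order to the ground floor of the
symmetric finite-volume Hamiltonian.  This entry records that the transfer step is not a general theorem: it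
is the unproved half of the Koma–Tasaki / Lieb–Seiringer–Yngvason equivalence, printed as open, and it FAILS for
explicit abstract systems sharing every structural feature that general (model-independent) arguments use.

## What is vendored (as printed)

* T. Koma, H. Tasaki, J. Stat. Phys. **76** (1994) 745–803 (`KomaTasaki1994`, held as
  `paper:arxiv-cond-mat_9708132`), §2.5 "Infinite volume ground states" (arXiv p. 11; the arXiv version numbers
  Corollary 2.9 / Conjecture 2.10 as Corollary 9 / Conjecture 10).  Two long-range-order parameters are defined: `μ₁`, from
  the infinite-volume (non-ergodic) ground state `ω` obtained as a limit of finite-volume ground states,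
  `μ₁ := lim_{Ω↑ℤ^d} (o|Ω|)⁻¹ √ω((O_Ω^{(1)})²)`, and `μ₂ := limsup (oN)⁻¹ √⟨Φ_Λ, (O_Λ^{(1)})² Φ_Λ⟩` over the
  finite-volume ground states `Φ_Λ` ("motivated by (LRO), one of the basic assumptions of the present paper").
  "It is quite likely that the above two definitions give the same result for a large class of systems.
  Unfortunately, we are only able to prove the one sided inequality `μ₁ ≥ μ₂`. (This follows from Lemma …)
  Let us proceed by assuming that the equality `μ₁ = μ₂` is valid."  With the symmetry-breaking order
  parameter `m` (ground states under the field `−B O^{(1)}`, `Λ ↑ ℤ^d` then `B ↓ 0`, Corollary 2.9):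
  `m ≥ √2 o μ` for `U(1)` (`√3 o μ` for `SU(2)`), i.e. finite-volume LRO ⇒ symmetry breaking; combining with the
  "conjectured `μ₁ = μ₂`" gives the "(plausible but nonrigorous) conclusion" `m = m_max`; Conjecture 2.10
  (the states `ω_θ` are the ergodic ground states): "Unfortunately we have no direct evidences which support
  the conjecture.  For systems with a discrete symmetry, however, we can prove that the statement corresponding
  to the above conjecture is in fact valid."
* E. H. Lieb, R. Seiringer, J. Yngvason, Rep. Math. Phys. **59** (2007) 389–399
  (`LiebSeiringerYngvason2007`, held as `paper:arxiv-math-ph_0610034`), §3, main inequality (roep)/(19):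
  `lim_{V→∞} V⁻¹⟨a₀*a₀⟩_{μ,λ=0} ≤ lim_{λ→0} lim_{V→∞} V⁻¹|⟨a₀⟩_{μ,λ}|²` (condensate density of the
  gauge-symmetric state ≤ squared quasi-average), proved by convexity of the pressure in `λ` and Griffiths'
  argument; then (arXiv p. 8): "Note, however, that a non-vanishing of the right side of (roep) does not a priori
  imply a non-vanishing of the left side. I.e., it is a priori possible that BEC only shows up after introducing
  an explicit gauge-breaking term to the Hamiltonian. While it is expected on physical grounds that positivity
  of the right side of (roep) implies positivity of the left side, a rigorous proof is lacking, so far."; and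
  (arXiv p. 9) the explicit weight profile `w_V(ζ) = V² − V + 1/V (|ζ| ≤ 1/V), 1/V (1/V ≤ |ζ| ≤ 1), 0 (|ζ| > 1)`
  for the distribution of `a₀/√V`: "This distribution converges for `V → ∞` to a δ-function at `ζ = 0`, and
  consequently there is no BEC at `λ = 0`. On the other hand, it is easy to see that the weight function
  `w_V(ζ)e^{−βλVζ}` … converges, for any `λ > 0`, to a δ-function at `ζ = −1` as `V → ∞`, and hence there is
  spontaneous symmetry breaking.  An open problem for the mathematician is to prove that examples like (junk5)
  do not occur in realistic bosonic systems."
* H. Tasaki, J. Stat. Phys. **174** (2019) 735–761 (`Tasaki2019Tower`, held as `paper:arxiv-1807.05847`), §5: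
  "We have repeated the argument of Kaplan, Horsch, and von der Linden to state Theorem [KHL], which shows that
  SSB can be triggered by infinitesimally small symmetry breaking field. Unfortunately the variational proof
  provides almost no information (except for the lower bound for the symmetry breaking order parameter) about
  the nature of the ground state obtained in this manner. It is desirable to have a method for controlling the
  ground state obtained by symmetry breaking field without using abstract variational principle.  In order to
  answer these (and other) open problems about symmetry breaking 'ground states', one probably should abandon
  the present general approach, and make use of specific properties [of] concrete models."; §3.2: "For the
  moment the existence of LRO associated with spontaneous breakdown of continuous symmetry can be proved only
  by using the reflection positivity method" (Dyson–Lieb–Simon; Kennedy–Lieb–Shastry for ground states).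
* W. F. Wreszinski, V. A. Zagrebnov, arXiv:1607.03024 (`WreszinskiZagrebnov2016`), Remark 4.5: the
  quasi-average questions of LSY are "elucidated" for continuous bosons through the perfect Bose gas and an
  ergodic-decomposition analysis (Theorem 4.1); no lattice-fermion or finite-volume-floor statement.

## Lean rendering

The printed no-go is LSY's abstract profile: nothing in the general (convexity / variational / selection-rule)
framework excludes "order only after the source".  It is rendered here, in the vocabulary the summit's items use
(`Matrix.minEnergyOn`, sectors as eigenspaces of a conserved charge, a pair field scaled extensively), by the
smallest system exhibiting the profile, and the headline `SourcedOrderWithoutGroundStateLRO` asserts its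
existence; `SourcedOrderWithoutGroundStateLRO_holds` proves it.  The witness (file-local notation, no new
definitions besides the headline): three levels `e₀, e₁, e₂`, Hamiltonian `H = diag(0, 1, 0)`, charge
`Q = diag(1, 1, 0)` (`[H, Q] = 0`), pair field `P = |e₂⟩⟨e₁|` of charge `−1` (`[Q, P] = −P`), extensive
scaling `P_L = L² P` (a pair field on `|Λ_L| = L²` sites has `‖Δ‖ = O(L²)`, order means `‖Δ v‖² ≍ L⁴`), sector
`K = {Q = 1} = span{e₀, e₁}` invariant under `H`.  Then, with every entry of `H` and `P` bounded by `1`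
uniformly in `L`:
  (a) ZERO-EXCESS ORDER in the sector: for every `ε > 0`, eventually in `L`, the unit charge eigenstate `e₁`
      has energy `≤ minEnergyOn H K + εL²` and `‖P_L e₁‖² = L⁴`;
  (b) UNIFORM LINEAR RESPONSE WITH POINTWISE ONSET to the `U(1)`-breaking pair source: for every `h > 0`,
      eventually in `L`, `minEnergyOn H ⊤ − minEnergyOn (H − h(P_L + P_Lᴴ)) ⊤ ≥ hL²/2` (trial state
      `(3e₁ + 4e₂)/5`; by concavity in `h` this is the Josephson-cusp / quasi-average side);
  (c) NO FLOOR ORDER, NO FLOOR BRIDGE: every ground state `g` of `H` in `K` (indeed every vector of the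
      ground space `span{e₀, e₂}` of `H`) has `P g = 0`, hence `‖P_L g‖² = 0` and `⟨χ, P_L g⟩ = 0` for all `χ`.
So (a) ∧ (b) ⇏ floor order, at the level of structure shared by all finite-dimensional `U(1)`-symmetric systems.
Within the Koma–Tasaki class `U1System` of `KomaTasakiSSB.lean` (local `h_x`, `o_x` with uniform norm and range
bounds) the same separation is realised by `N` independent spins in the vanishing field `B_N = N^{-1/2}`
(`h_x = B_N S^z_x`, `o = (S^x, S^y)`, `C = Σ S^z`): the floor `|⇓⟩` is unique with gap `B_N` and
`⟨(O^{(1)})²⟩ = N/4 = o(N²)`, while the `C = 0` Dicke state has excess energy `B_N N/2 = o(N)` and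
`⟨(O^{(1)})²⟩ = N(N+2)/8`, and under the field `−B O^{(1)}` (`N → ∞` then `B ↓ 0`) the order parameter is the
maximal `o = 1/2` [folklore; not formalised here].  What both witnesses lack is a translation-invariant
interaction that does NOT depend on the volume; no theorem exploiting that property to prove the transfer is
known (status below).

## Mathlib / tree search

Mathlib: nothing on order parameters or symmetry breaking.  Tree: `KomaTasakiSSB.lean` (KT Theorems 2.2–2.5,
finite volume; its header records "The converse direction (symmetry breaking under an infinitesimal field ⟹ LRO
of every finite-volume ground state) is not a Koma–Tasaki theorem"), `DWaveSource.lean`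
(`dWaveOrderParameter`: KT §1 sourced order parameter for `Δ_d`), `LROForcesLowLyingStates.lean` (this
catalogue: the proved direction's companion, KT Theorem 2.2), `FinDimSpectrumSectorGibbsLimit.lean`
(`minEnergyOn_le_rayleigh_of_mem`, used below).  Summit-side instances of the blocked step (ledger, 2026-08-17):
`JosephsonMirror.JmInterchange` (stmt-2227; by the tree theorem `jmInterchange_iff_singleLayerForm` it is
literally "zero-excess `d`-wave pair order ⇒ ground-floor pair bridge" at every `(U, δ)`, and its abstract
failure in the exact window-double packaging is `Theorems/JmInterchange/Negative/AbstractWindowInterchangeFalse`),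
`WeakCouplingBCS.WcbcsSsbToTorusLRO` (stmt-2009), `ChiralWindow.CwSsbToEvenTorusLRO` (stmt-10439),
`AposterioriCapRg.SsbToEvenTorusLro` (stmt-1315) (sourced `d`-wave order parameter ⇒ LRO of even-torus sector
ground states; sibling abstract failure `Theorems/WcbcsSsbToTorusLRO/Negative/AbstractConverseFalse`).

## References

* T. Koma, H. Tasaki, J. Stat. Phys. 76 (1994) 745–803, arXiv:cond-mat/9708132: §2.5 (μ₁, μ₂, "only … μ₁ ≥ μ₂"),
  Corollary 2.9, Conjecture 2.10 (arXiv: 9, 10), Appendix (discrete symmetry).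
* E. H. Lieb, R. Seiringer, J. Yngvason, Rep. Math. Phys. 59 (2007) 389–399, arXiv:math-ph/0610034: §3, (roep),
  the profile (junk5) and the open problem.
* H. Tasaki, J. Stat. Phys. 174 (2019) 735–761, arXiv:1807.05847: §3.2, Theorems 3.3–3.5, §5.
* T. Kennedy, E. H. Lieb, B. S. Shastry, J. Stat. Phys. 53 (1988) 1019 (`KennedyLiebShastry1988`): ground-state
  LRO by reflection positivity (the evasion that proves LRO directly).
* T. A. Kaplan, P. Horsch, W. von der Linden, J. Phys. Soc. Jpn. 58 (1989) 3894 (`KaplanHorschVonDerLinden1989`):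
  LRO ⇒ symmetry breaking under an infinitesimal field.
* W. F. Wreszinski, V. A. Zagrebnov, arXiv:1607.03024: Remark 4.5.
-/

noncomputable section

open Matrix Complex
open scoped ComplexOrder

namespace Literature.Barriers.HubbardSuperconductivity

open Literature.MathematicalPhysics.QuantumLattice

/-- **BARRIER `SourcedOrderWithoutGroundStateLRO` (Koma–Tasaki 1994 §2.5; Lieb–Seiringer–Yngvason 2007 §3).**
There is a finite-dimensional `U(1)`-symmetric system — a Hermitian `H`, a Hermitian charge `Q` commuting with
`H`, a pair field `P` lowering the charge by one unit (`QP − PQ = −P`), the `H`-invariant charge sector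
`K = {v | Qv = v}`, all matrix entries of `H` and `P` bounded by `1` independently of the volume parameter `L`,
and the extensively scaled pair field `P_L = L²P` — such that (a) ZERO-EXCESS ORDER holds in the sector (for
every `ε > 0`, eventually in `L`, a unit `v ∈ K` has energy `≤ minEnergyOn H K + εL²` and `‖P_L v‖² ≥ L⁴`),
(b) the energy RESPONSE to the `U(1)`-breaking source is uniformly linear with pointwise onset (for every
`h > 0`, eventually in `L`, `minEnergyOn H ⊤ − minEnergyOn (H − h(P_L + P_Lᴴ)) ⊤ ≥ hL²/2`), and yet (c) every
ground state of `H` in `K` is annihilated by `P` (no floor order `‖P_L g‖²`, no floor bridge `⟨χ, P_L g⟩`).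
This is the finite-dimensional form of LSY's profile (junk5): "it is a priori possible that BEC only shows up
after introducing an explicit gauge-breaking term".

technique_class: symmetry-breaking-field SSB-field quasi-average infinitesimal-source Koma-Tasaki-converse SSB-to-LRO-transfer energy-cusp Josephson-mirror concavity-in-coupling Feynman-Hellmann zero-excess-order interchange-of-limits
blocks: every route step of the shape "order visible after the thermodynamic limit under an infinitesimal `U(1)`-breaking source (quasi-average `lim_{h↓0} lim_Λ ⟨O_Λ⟩/|Λ| > 0`, a linear energy response `E_Λ(0) − E_Λ(h) ≥ a h |Λ|` with `h`-dependent volume threshold, or order `≥ c|Λ|²` in sector states of excess energy `o(|Λ|)`) ⇒ long-range order `⟨O_Λ† O_Λ⟩ ≥ c′|Λ|²` (or a pair bridge `|⟨χ, O_Λ Φ⟩|² ≥ c′|Λ|²`) in the ground states of the SYMMETRIC finite-volume Hamiltonian" whenever the step is to be carried by structure the abstract witnesses share — Hermiticity, `U(1)` selection rules, convexity/concavity and the two-sided Feynman–Hellmann sandwich in the source strength, simplicity and a gap of each finite-volume sector floor (this file's three-level witness); Koma–Tasaki-type uniform locality and norm bounds in addition (the vanishing-field spin family of the module docstring, not formalised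 here); and, for the Josephson-mirror packaging, positivity of the doubled system (abstract failure recorded summit-side) [cite: LiebSeiringerYngvason2007, §3 (arXiv pp. 8–9)] [cite: KomaTasaki1994, §2.5]; in this summit the transfer cruxes "sourced / zero-excess `d`-wave pair order ⇒ pair LRO (or pair bridge) of the even-torus sector ground states at every admissible `(U, δ)`" contain this step as their load-bearing implication.
because: LSY prove only `lim_V V⁻¹⟨a₀*a₀⟩_{λ=0} ≤ lim_{λ→0} lim_V V⁻¹|⟨a₀⟩_λ|²` and exhibit a weight profile with quasi-average order and no condensation, "a non-vanishing of the right side of (roep) does not a priori imply a non-vanishing of the left side … a rigorous proof is lacking, so far" [cite: LiebSeiringerYngvason2007, §3 (roep) and (junk5)]; Koma–Tasaki prove only `μ₁ ≥ μ₂` and `m ≥ √2 o μ₂` (finite-volume LRO ⇒ order under an infinitesimal field) and must ASSUME `μ₁ = μ₂`: "Unfortunately, we are only able to prove the one sided inequality" [cite: KomaTasaki1994, §2.5 and Corollary 2.9]; the three-level witness of this file has (a), (b) and (c) simultaneously (`SourcedOrderWithoutGroundStateLRO_holds`), so no argument using only the structure it carries can effect the transfer.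
evasions_known: (i) prove ground-state LRO DIRECTLY by spatial reflection positivity and infrared bounds [cite: KennedyLiebShastry1988] — "can be proved only by using the reflection positivity method" [cite: Tasaki2019Tower, §3.2] — unavailable for real-hopping lattice fermions away from half filling; (ii) strengthen the hypothesis to floor-level input — an order gap / energetic rigidity of the finite-volume floor, isolation of the adjacent-charge floor at a divergent scale together with response at mesoscopic source strength, or a volume-UNIFORM onset of the linear response — under which the transfer is elementary (but the hypothesis then contains the conclusion's floor information); (iii) use the PROVED direction instead: LRO of the finite-volume ground states ⇒ symmetry breaking under an infinitesimal field with `m ≥ √2 o μ` [cite: KomaTasaki1994, Corollary 2.9] [cite: KaplanHorschVonDerLinden1989] [cite: Tasaki2019Tower, Theorems 3.3–3.5]; (iv) discrete symmetries, where the corresponding statement is proved [cite: KomaTasaki1994, §2.5 last remark and Appendix]; (v) model-specific control of the source-selected ground states, which is exactly what is asked for and not available: "one probably should abandon the present general approach, and make use of specific properties [of] concrete models" [cite: Tasaki2019Tower, §5 (quoted in full in the module docstring)].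
scope_caveats: the witnesses are NOT translation-invariant local Hamiltonians with a volume-independent interaction — the three-level system has fixed dimension (the volume enters only through the extensive scaling `P_L = L²P` and the excess allowance `εL²`), and the Koma–Tasaki-class spin witness described in the module docstring uses a field `B_N → 0`; for a fixed finite-range interaction on `ℤ^d` no counterexample to "quasi-average order ⇒ ground-state LRO" is in print and none is claimed here: there the transfer is unproved and unrefuted, "expected on physical grounds" [cite: LiebSeiringerYngvason2007, §3], "quite likely … for a large class of systems" [cite: KomaTasaki1994, §2.5], and can physically fail only at fine-tuned first-order coexistence points where an order-free phase wins the finite-volume floors by `o(|Λ|)`; the entry therefore blocks PROOF STRATEGIES for the transfer that do not use the model beyond the listed structure — it does not refute any model instance, says nothing about the easy direction (iii), and nothing about `T > 0` (see `HohenbergMerminWagnerPairing`, `PositiveTemperatureNoPairLRO` in this catalogue).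
status: established (theorem `SourcedOrderWithoutGroundStateLRO_holds` below; printed profile [cite: LiebSeiringerYngvason2007, §3 (junk5)]; one-sidedness of the printed theory [cite: KomaTasaki1994, §2.5 "only … the one sided inequality μ₁ ≥ μ₂"]); for translation-invariant volume-independent interactions the transfer is neither proved nor refuted in print — "a rigorous proof is lacking, so far" [cite: LiebSeiringerYngvason2007, §3], [cite: Tasaki2019Tower, §5] — which is what makes this an obstruction to general arguments rather than a refutation of any model instance (see scope_caveats).
[cite: LiebSeiringerYngvason2007, §3] [cite: KomaTasaki1994, §2.5] -/
def SourcedOrderWithoutGroundStateLRO : Prop :=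
  ∃ (n : Type) (_ : Fintype n) (_ : DecidableEq n) (H Q P : Matrix n n ℂ) (K : Submodule ℂ (n → ℂ)),
    H.IsHermitian ∧ Q.IsHermitian ∧ H * Q = Q * H ∧ Q * P - P * Q = -P ∧
    (∀ v, v ∈ K ↔ Q *ᵥ v = v) ∧ (∀ v ∈ K, H *ᵥ v ∈ K) ∧
    (∀ i j, ‖H i j‖ ≤ 1) ∧ (∀ i j, ‖P i j‖ ≤ 1) ∧
    -- (a) zero-excess order in the sector `K`, pair field `P_L = L² P`
    (∀ ε : ℝ, 0 < ε → ∃ L₀ : ℕ, ∀ L : ℕ, L₀ ≤ L → ∃ v ∈ K, star v ⬝ᵥ v = 1 ∧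
        (star v ⬝ᵥ (H *ᵥ v)).re ≤ H.minEnergyOn K + ε * (L : ℝ) ^ 2 ∧
        (L : ℝ) ^ 4 ≤ (star ((((L : ℂ)) ^ 2 • P) *ᵥ v) ⬝ᵥ ((((L : ℂ)) ^ 2 • P) *ᵥ v)).re) ∧
    -- (b) uniformly linear energy response to the `U(1)`-breaking pair source, pointwise onset in `L`
    (∀ h : ℝ, 0 < h → ∃ L₀ : ℕ, ∀ L : ℕ, L₀ ≤ L →
        h * (L : ℝ) ^ 2 / 2 ≤
          H.minEnergyOn ⊤ -
            (H - (h : ℂ) • ((((L : ℂ)) ^ 2 • P) + (((L : ℂ)) ^ 2 • P)ᴴ)).minEnergyOn ⊤) ∧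
    -- (c) no floor order, no floor bridge: every ground state of `H` in `K` is annihilated by `P`
    (∀ g ∈ K, H *ᵥ g = ((H.minEnergyOn K : ℝ) : ℂ) • g → P *ᵥ g = 0)

/-! ### The three-level witness (file-local notation) -/

/-- Witness Hamiltonian `diag(0, 1, 0)` on `ℂ³`. -/
local notation "bH" => (Matrix.diagonal ![(0 : ℂ), 1, 0] : Matrix (Fin 3) (Fin 3) ℂ)
/-- Witness charge `diag(1, 1, 0)`. -/
local notation "bQ" => (Matrix.diagonal ![(1 : ℂ), 1, 0] : Matrix (Fin 3) (Fin 3) ℂ)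
/-- Witness pair field `|e₂⟩⟨e₁|`. -/
local notation "bP" => (Matrix.single (2 : Fin 3) (1 : Fin 3) (1 : ℂ) : Matrix (Fin 3) (Fin 3) ℂ)
/-- Witness sector `{v | v 2 = 0} = span{e₀, e₁}`. -/
local notation "bK" => (LinearMap.ker (LinearMap.proj (R := ℂ) (φ := fun _ : Fin 3 => ℂ) (2 : Fin 3)) :
  Submodule ℂ (Fin 3 → ℂ))

/-- Membership in the witness sector: `v ∈ K ↔ v 2 = 0`. [folklore] -/
theorem b_mem_K (v : Fin 3 → ℂ) : v ∈ bK ↔ v 2 = 0 := by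
  simp [LinearMap.mem_ker]

/-- `H v` in coordinates: `(0, v 1, 0)`. [folklore] -/
theorem bH_mulVec (v : Fin 3 → ℂ) : bH *ᵥ v = ![0, v 1, 0] := by
  ext i
  rw [Matrix.mulVec_diagonal]
  fin_cases i <;> simp

/-- `Q v` in coordinates: `(v 0, v 1, 0)`. [folklore] -/
theorem bQ_mulVec (v : Fin 3 → ℂ) : bQ *ᵥ v = ![v 0, v 1, 0] := by
  ext i
  rw [Matrix.mulVec_diagonal]
  fin_cases i <;> simp

/-- `P v` in coordinates: `(0, 0, v 1)`. [folklore] -/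
theorem bP_mulVec (v : Fin 3 → ℂ) : bP *ᵥ v = ![0, 0, v 1] := by
  ext i
  fin_cases i <;> simp [Matrix.mulVec, dotProduct, Matrix.single_apply]

/-- The Rayleigh quotient of the witness Hamiltonian: `Re⟨v, H v⟩ = |v 1|²`. [folklore] -/
theorem b_rayleigh (v : Fin 3 → ℂ) : (star v ⬝ᵥ (bH *ᵥ v)).re = ‖v 1‖ ^ 2 := by
  rw [bH_mulVec, dotProduct, Fin.sum_univ_three]
  simp only [Pi.star_apply, Matrix.cons_val_zero, Matrix.cons_val_one, Matrix.head_cons,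
    Matrix.cons_val_two, Matrix.tail_cons, mul_zero, zero_add, add_zero]
  rw [Complex.star_def, ← Complex.normSq_eq_conj_mul_self, Complex.normSq_eq_norm_sq]
  norm_cast

/-- The witness Hamiltonian is positive: `0 ≤ Re⟨v, H v⟩`. [folklore] -/
theorem b_rayleigh_nonneg (v : Fin 3 → ℂ) : 0 ≤ (star v ⬝ᵥ (bH *ᵥ v)).re := by
  rw [b_rayleigh]; positivity

/-- The sector energy of the witness is `0` on any subspace containing `e₀`. [folklore] -/
theorem b_minEnergyOn_eq_zero (K : Submodule ℂ (Fin 3 → ℂ)) (h0 : Pi.single (0 : Fin 3) (1 : ℂ) ∈ K) :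
    (bH).minEnergyOn K = 0 := by
  unfold Matrix.minEnergyOn
  refine IsLeast.csInf_eq ⟨?_, ?_⟩
  · refine ⟨Pi.single 0 1, h0, ?_, ?_⟩
    · simp
    · rw [b_rayleigh]; simp
  · rintro E ⟨ψ, -, -, rfl⟩
    exact b_rayleigh_nonneg ψ

/-- The witness sector energy: `minEnergyOn H K = 0`. [folklore] -/
theorem b_minEnergyOn_K : (bH).minEnergyOn bK = 0 :=
  b_minEnergyOn_eq_zero _ ((b_mem_K _).2 (by simp))

/-- The witness ground energy: `minEnergyOn H ⊤ = 0`. [folklore] -/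
theorem b_minEnergyOn_top : (bH).minEnergyOn ⊤ = 0 :=
  b_minEnergyOn_eq_zero _ Submodule.mem_top

/-- The sourced witness Hamiltonian `H − h(P_L + P_Lᴴ)` is Hermitian. [folklore] -/
theorem b_sourced_isHermitian (h : ℝ) (L : ℕ) :
    (bH - (h : ℂ) • ((((L : ℂ)) ^ 2 • bP) + (((L : ℂ)) ^ 2 • bP)ᴴ)).IsHermitian := by
  have hH : (bH).IsHermitian := by
    rw [Matrix.IsHermitian, Matrix.diagonal_conjTranspose]
    congr 1
    ext i; fin_cases i <;> simp
  refine hH.sub ?_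
  have hS : ((((L : ℂ)) ^ 2 • bP) + (((L : ℂ)) ^ 2 • bP)ᴴ).IsHermitian := by
    rw [Matrix.IsHermitian, Matrix.conjTranspose_add, Matrix.conjTranspose_conjTranspose, add_comm]
  unfold Matrix.IsHermitian at hS ⊢
  rw [Matrix.conjTranspose_smul, hS]
  simp

/-- The trial state `(0, 3/5, 4/5)` has energy `9/25 − (24/25) h L²` in the sourced witness Hamiltonian.
[folklore] -/
theorem b_trial_energy (h : ℝ) (L : ℕ) :
    (star (![0, 3 / 5, 4 / 5] : Fin 3 → ℂ) ⬝ᵥ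
        ((bH - (h : ℂ) • ((((L : ℂ)) ^ 2 • bP) + (((L : ℂ)) ^ 2 • bP)ᴴ)) *ᵥ ![0, 3 / 5, 4 / 5])).re =
      9 / 25 - 24 / 25 * h * (L : ℝ) ^ 2 := by
  rw [Matrix.sub_mulVec, Matrix.smul_mulVec, Matrix.add_mulVec, Matrix.smul_mulVec,
    Matrix.conjTranspose_smul, Matrix.smul_mulVec, bH_mulVec, bP_mulVec]
  have hPt : (bP)ᴴ *ᵥ (![0, 3 / 5, 4 / 5] : Fin 3 → ℂ) = ![0, 4 / 5, 0] := by
    ext i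
    fin_cases i <;>
      simp [Matrix.mulVec, dotProduct, Matrix.conjTranspose_apply, Matrix.single_apply]
  rw [hPt, dotProduct, Fin.sum_univ_three]
  simp only [Pi.star_apply, Pi.sub_apply, Pi.smul_apply, Pi.add_apply, Matrix.cons_val_zero,
    Matrix.cons_val_one, Matrix.head_cons, Matrix.cons_val_two, Matrix.tail_cons, smul_eq_mul]
  simp only [Complex.star_def, map_zero, zero_mul, zero_add, mul_zero, add_zero, Complex.sub_re,
    Complex.mul_re, Complex.add_re, Complex.mul_im]
  have h3 : (starRingEnd ℂ) (3 / 5 : ℂ) = 3 / 5 := by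
    rw [map_div₀]; simp [map_ofNat]
  have h4 : (starRingEnd ℂ) (4 / 5 : ℂ) = 4 / 5 := by
    rw [map_div₀]; simp [map_ofNat]
  rw [h3, h4]
  simp only [map_pow, Complex.conj_natCast]
  norm_num [Complex.div_re, Complex.div_im, pow_succ, Complex.mul_re, Complex.mul_im]
  ring

/-- **The barrier is a theorem** (abstract level): the three-level `U(1)` system realises (a) zero-excess order,
(b) uniformly linear response with pointwise onset, and (c) order-free ground floors simultaneously.
[cite: LiebSeiringerYngvason2007, §3 (junk5)] -/
theorem SourcedOrderWithoutGroundStateLRO_holds : SourcedOrderWithoutGroundStateLRO := by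
  refine ⟨Fin 3, inferInstance, inferInstance, bH, bQ, bP, bK, ?_, ?_, ?_, ?_, ?_, ?_, ?_, ?_, ?_, ?_, ?_⟩
  · -- `H` Hermitian
    rw [Matrix.IsHermitian, Matrix.diagonal_conjTranspose]
    congr 1
    ext i; fin_cases i <;> simp
  · -- `Q` Hermitian
    rw [Matrix.IsHermitian, Matrix.diagonal_conjTranspose]
    congr 1
    ext i; fin_cases i <;> simp
  · -- `[H, Q] = 0`
    rw [Matrix.diagonal_mul_diagonal, Matrix.diagonal_mul_diagonal]
    congr 1
    ext i; fin_cases i <;> simp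
  · -- `[Q, P] = -P`
    ext i j
    fin_cases i <;> fin_cases j <;>
      simp [Matrix.mul_apply, Matrix.single_apply, Matrix.diagonal]
  · -- `K = {Q = 1}`
    intro v
    rw [b_mem_K, bQ_mulVec]
    constructor
    · intro h2
      ext i; fin_cases i <;> simp [h2]
    · intro hv
      have := congr_fun hv 2
      simpa using this.symm
  · -- `K` is `H`-invariant
    intro v _
    rw [b_mem_K, bH_mulVec]
    simp
  · -- entries of `H` bounded by `1`
    intro i j
    fin_cases i <;> fin_cases j <;> simp [Matrix.diagonal]
  · -- entries of `P` bounded by `1`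
    intro i j
    fin_cases i <;> fin_cases j <;> simp
  · -- (a) zero-excess order: `v = e₁`
    intro ε hε
    refine ⟨⌈1 / ε⌉₊ + 1, fun L hL => ⟨Pi.single 1 1, (b_mem_K _).2 (by simp), by simp, ?_, ?_⟩⟩
    · rw [b_minEnergyOn_K, b_rayleigh, zero_add]
      have hL1 : (1 : ℝ) ≤ L := by exact_mod_cast (Nat.le_add_left 1 _).trans hL
      have hLε : 1 / ε ≤ (L : ℝ) :=
        (Nat.le_ceil _).trans (by exact_mod_cast (Nat.le_succ _).trans hL)
      have hε1 : 1 ≤ ε * (L : ℝ) := by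
        rw [div_le_iff₀ hε] at hLε; linarith [mul_comm (L : ℝ) ε]
      calc ‖(Pi.single (1 : Fin 3) (1 : ℂ) : Fin 3 → ℂ) 1‖ ^ 2 = 1 := by simp
        _ ≤ ε * (L : ℝ) * 1 := by linarith
        _ ≤ ε * (L : ℝ) * L := by gcongr
        _ = ε * (L : ℝ) ^ 2 := by ring
    · have hv : (((L : ℂ)) ^ 2 • bP) *ᵥ (Pi.single (1 : Fin 3) (1 : ℂ) : Fin 3 → ℂ) =
          ![0, 0, ((L : ℂ)) ^ 2] := by
        rw [Matrix.smul_mulVec, bP_mulVec]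
        ext i; fin_cases i <;> simp
      rw [hv, dotProduct, Fin.sum_univ_three]
      simp only [Pi.star_apply, Matrix.cons_val_zero, Matrix.cons_val_one, Matrix.head_cons,
        Matrix.cons_val_two, Matrix.tail_cons, star_zero, zero_mul, zero_add]
      rw [Complex.star_def, map_pow, Complex.conj_natCast, ← Complex.ofReal_natCast, ← Complex.ofReal_pow,
        ← Complex.ofReal_mul, Complex.ofReal_re]
      exact le_of_eq (by ring)
  · -- (b) linear response with pointwise onset: trial state `(0, 3/5, 4/5)`, threshold `h L² ≥ 1`
    intro h hh
    refine ⟨⌈1 / h⌉₊ + 1, fun L hL => ?_⟩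
    have hL1 : (1 : ℝ) ≤ L := by exact_mod_cast (Nat.le_add_left 1 _).trans hL
    have hLh : 1 / h ≤ (L : ℝ) :=
      (Nat.le_ceil _).trans (by exact_mod_cast (Nat.le_succ _).trans hL)
    have hh1 : 1 ≤ h * (L : ℝ) ^ 2 := by
      rw [div_le_iff₀ hh] at hLh
      nlinarith
    have htrial := minEnergyOn_le_rayleigh_of_mem (b_sourced_isHermitian h L) ⊤
      (ψ := (![0, 3 / 5, 4 / 5] : Fin 3 → ℂ)) Submodule.mem_top (by
        rw [dotProduct, Fin.sum_univ_three]
        simp [Complex.ext_iff]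
        norm_num)
    rw [b_trial_energy] at htrial
    rw [b_minEnergyOn_top]
    nlinarith
  · -- (c) ground states in `K` are annihilated by `P`
    intro g hg hHg
    rw [b_minEnergyOn_K, bH_mulVec] at hHg
    have h1 : g 1 = 0 := by
      have := congr_fun hHg 1
      simpa using this
    rw [bP_mulVec, h1]
    ext i; fin_cases i <;> simp

/-- **Corollary: the converse schema is not a theorem of the shared structure.**  It is NOT the case that, for
every finite-dimensional `U(1)`-symmetric system as in the headline, zero-excess order in a charge sector
forces some ground state of that sector to carry pair-field order `‖P_L g‖² ≥ c L⁴` eventually — the shape of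
the summit's transfer steps (`ZeroExcessPairOrder → FloorOrder`). [cite: LiebSeiringerYngvason2007, §3] -/
theorem not_zeroExcessOrder_forces_floorOrder :
    ¬ ∀ (n : Type) (_ : Fintype n) (_ : DecidableEq n) (H Q P : Matrix n n ℂ) (K : Submodule ℂ (n → ℂ)),
      H.IsHermitian → Q.IsHermitian → H * Q = Q * H → Q * P - P * Q = -P →
      (∀ v, v ∈ K ↔ Q *ᵥ v = v) → (∀ v ∈ K, H *ᵥ v ∈ K) →
      (∀ i j, ‖H i j‖ ≤ 1) → (∀ i j, ‖P i j‖ ≤ 1) →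
      (∀ ε : ℝ, 0 < ε → ∃ L₀ : ℕ, ∀ L : ℕ, L₀ ≤ L → ∃ v ∈ K, star v ⬝ᵥ v = 1 ∧
          (star v ⬝ᵥ (H *ᵥ v)).re ≤ H.minEnergyOn K + ε * (L : ℝ) ^ 2 ∧
          (L : ℝ) ^ 4 ≤ (star ((((L : ℂ)) ^ 2 • P) *ᵥ v) ⬝ᵥ ((((L : ℂ)) ^ 2 • P) *ᵥ v)).re) →
      ∃ c : ℝ, 0 < c ∧ ∃ L₀ : ℕ, ∀ L : ℕ, L₀ ≤ L → ∃ g ∈ K, star g ⬝ᵥ g = 1 ∧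
        H *ᵥ g = ((H.minEnergyOn K : ℝ) : ℂ) • g ∧
        c * (L : ℝ) ^ 4 ≤ (star ((((L : ℂ)) ^ 2 • P) *ᵥ g) ⬝ᵥ ((((L : ℂ)) ^ 2 • P) *ᵥ g)).re := by
  intro hall
  obtain ⟨n, hn, hdec, H, Q, P, K, hH, hQ, hHQ, hQP, hK, hKinv, hHb, hPb, hzepo, -, hfloor⟩ :=
    SourcedOrderWithoutGroundStateLRO_holds
  obtain ⟨c, hc, L₀, hL₀⟩ := hall n hn hdec H Q P K hH hQ hHQ hQP hK hKinv hHb hPb hzepo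
  obtain ⟨g, hgK, -, hHg, hord⟩ := hL₀ (L₀ + 1) (Nat.le_succ _)
  have hPg : P *ᵥ g = 0 := hfloor g hgK hHg
  rw [Matrix.smul_mulVec, hPg, smul_zero, dotProduct_zero, Complex.zero_re] at hord
  have : (0 : ℝ) < c * ((L₀ + 1 : ℕ) : ℝ) ^ 4 := by positivity
  linarith

end Literature.Barriers.HubbardSuperconductivity
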